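import Literature.AlgebraicGeometry.Motives.AlbaneseHomNonvanishing
import HarnessLib

/-!
# A morphism to an abelian variety is constant iff it kills `H¹(−; ℚ)`

Topic `Literature/AlgebraicGeometry/Motives`, sequel of `AlbaneseHomNonvanishing`. PROOF FILE: theorems only — no
definition, no named fact, sorry-free (D-0026).

Let `X/ℂ` be smooth projective (so that it has an Albanese datum `𝒥 : Jacobian X`,
`nonempty_jacobian_of_isSmoothProjective_complex_of_dim`, and a point `P`), `A/ℂ` an abelian variety and
`F : X → A` a morphism. Write `F = t_{F(P)} ∘ u_F ∘ f^P` with `u_F : Alb X → A` the homomorphism of the universal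
property (Milne, *Jacobian Varieties* Prop. 6.1 = the tree's `Jacobian.descPointed`; Lange–Birkenhake Prop. 1.1.6
for complex tori). Then

* `hom_bettiCohomology_map_one_one_eq_zero` — the unit constant morphism `1 : X → A` (`x ↦ 0`) kills `H¹(−; ℚ)`:
  `1 = f^P ≫ 0_{Alb X → A}` and the zero homomorphism kills `H¹` (`bettiCohomology_map_zero_one`);
* `hom_bettiCohomology_map_one_const_eq_zero` — every CONSTANT morphism `X → Spec ℂ → A` kills `H¹(−; ℚ)`
  (translations act trivially on cohomology, `AbelianVariety.bettiCohomology_map_mul_const`);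
* **`eq_const_of_hom_bettiCohomology_map_one_eq_zero`** — conversely, **if `F^* = 0` on `H¹(−(ℂ); ℚ)` then `F` is
  CONSTANT**, `F = (X → Spec ℂ) ≫ F(P)`: `F^* = (f^P)^* ∘ u_F^*` with `(f^P)^*` injective
  (`Jacobian.injective_bettiCohomology_map_abelJacobi_one_of_dim`) forces `u_F^* = 0`, the rational representation
  is faithful (`hom_eq_zero_of_bettiCohomology_map_one_eq_zero`, Lange–Birkenhake §1.1.2) so `u_F = 0`, and then
  `F − F(P) = u_F ∘ f^P = 0`;
* **`hom_bettiCohomology_map_one_eq_zero_iff_exists_eq_const`** — `F^* = 0` on `H¹(−; ℚ)` iff `F` is constant;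
* **`exists_ne_const_iff_exists_hom_ne_zero`** — **`X` admits a NON-CONSTANT morphism to `A` iff `Hom(Alb X, A) ≠ 0`**
  (with `Jacobian.exists_hom_bettiCohomology_map_ne_zero_iff_exists_hom_ne_zero`): the classical form of the
  Albanese dictionary (Bădescu Thm. 5.3 / Remark: the Albanese map is universal and `Alb X` is generated by `X`).

Consumer: the Hodge-CM cell (junction B01): «`P_Γ` admits a non-constant morphism to the CM abelian variety
`A_{(F,ψ)}`» ⟺ «`A_{(F,ψ)}` meets `Alb(P_Γ)`» (Murty–Ramakrishnan 1992; Liu 2021 Cor. 4.20).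

## References

* [Milne1986JacobianVarieties] J. S. Milne, *Jacobian Varieties* (1986), §6 Prop. 6.1.
* [Badescu2001] L. Bădescu, *Algebraic Surfaces* (2001), Ch. 5 Def. 5.2 / Thm. 5.3.
* [LangeBirkenhake1992] H. Lange, Ch. Birkenhake, *Complex Abelian Varieties* (1992), §1.1.2 Prop. 1.1.6 and the
  injectivity of the rational representation `ρ_r` (p. 10).
* [HatcherAT2002] A. Hatcher, *Algebraic Topology* (2002), §3.1 p. 201 (homotopy invariance).
-/

noncomputable section

open CategoryTheory AlgebraicGeometry MonObj

namespace Literature.AlgebraicGeometry.Motives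

open Literature.AlgebraicGeometry.ComplexMultiplication

variable {d : ℕ} {X : SchemeOver ℂ} (A : AbelianVariety ℂ)

/-! ### Constant morphisms kill `H¹` -/

/-- The underlying morphism of the zero homomorphism `0 : J → A` is the unit `1 : J → A` of the group of
`A`-valued morphisms (the constant morphism `x ↦ 0`). [folklore] -/
private theorem AbelianVariety.hom_hom_hom_zero (J : AbelianVariety ℂ) : (0 : J ⟶ A).hom.hom.hom = (1 : J.X ⟶ A.X) :=
  rfl

/-- **The unit constant morphism `1 : X → A` (`x ↦ 0`) kills `H¹(−(ℂ); ℚ)`** (`X` smooth projective): through an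
Albanese datum, `1 = f^P ≫ 0_{Alb X → A}` and `0^* = 0` on `H¹` (`bettiCohomology_map_zero_one`).
[cite: LangeBirkenhake1992, §1.1.2 (ρ_r additive; p. 10)] [cite: Milne1986JacobianVarieties, §6 Prop. 6.1] -/
theorem hom_bettiCohomology_map_one_one_eq_zero (hX : IsSmoothProjective d X) :
    (bettiCohomology.map (1 : X ⟶ A.X) 1).hom = 0 := by
  obtain ⟨𝒥⟩ := nonempty_jacobian_of_isSmoothProjective_complex_of_dim X hX
  obtain ⟨P⟩ := hX.nonempty_algPoints ℂ
  have h1 : (1 : X ⟶ A.X) = 𝒥.abelJacobi P ≫ (0 : 𝒥.J ⟶ A).hom.hom.hom := by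
    rw [AbelianVariety.hom_hom_hom_zero, MonObj.comp_one]
  rw [h1, bettiCohomology.map_comp, bettiCohomology_map_zero_one, Limits.zero_comp]
  rfl

/-- **A constant morphism `X → Spec ℂ → A` kills `H¹(−(ℂ); ℚ)`** (`X` smooth projective): it is the translate
`1 · a` of the unit constant morphism, and translations act trivially on cohomology
(`AbelianVariety.bettiCohomology_map_mul_const`). [cite: HatcherAT2002, §3.1 p. 201]
[cite: LangeBirkenhake1992, §1.1.2 (p. 10)] -/
theorem hom_bettiCohomology_map_one_const_eq_zero (hX : IsSmoothProjective d X) (a : A.Points ℂ) :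
    (bettiCohomology.map (toSpecOver X ≫ a) 1).hom = 0 := by
  rw [← _root_.one_mul (toSpecOver X ≫ a), AbelianVariety.bettiCohomology_map_mul_const]
  exact hom_bettiCohomology_map_one_one_eq_zero A hX

/-! ### A morphism killing `H¹` is constant -/

/-- **A morphism from a smooth projective complex variety to an abelian variety that kills `H¹(−(ℂ); ℚ)` is
CONSTANT**: `F = (X → Spec ℂ) ≫ F(P)` for every point `P`. Proof: `F^* = (f^P)^* ∘ u_F^*`
(`Jacobian.bettiCohomology_map_eq_comp_abelJacobi`) with `(f^P)^*` injective on `H¹(−; ℚ)` gives `u_F^* = 0`; the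
rational representation is faithful, so `u_F = 0`; hence `F · F(P)⁻¹ = u_F ∘ f^P` is the unit constant morphism.
[cite: Milne1986JacobianVarieties, §6 Prop. 6.1] [cite: LangeBirkenhake1992, §1.1.2 (ρ_r injective, after Prop. 1.1.6; p. 10)]
[cite: Badescu2001, Ch. 5 Def. 5.2] -/
theorem eq_const_of_hom_bettiCohomology_map_one_eq_zero (hX : IsSmoothProjective d X) (P : AlgPoints X ℂ)
    (F : X ⟶ A.X) (hF : (bettiCohomology.map F 1).hom = 0) : F = toSpecOver X ≫ (P ≫ F) := by
  obtain ⟨𝒥⟩ := nonempty_jacobian_of_isSmoothProjective_complex_of_dim X hX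
  have hu : (bettiCohomology.map
      (𝒥.descPointed P _ (Jacobian.point_comp_mul_const_inv P F)).hom.hom.hom 1).hom = 0 := by
    ext β
    rw [LinearMap.zero_apply]
    apply 𝒥.injective_bettiCohomology_map_abelJacobi_one_of_dim hX P
    have h := LinearMap.congr_fun
      (congrArg ModuleCat.Hom.hom (𝒥.bettiCohomology_map_eq_comp_abelJacobi P F 1)) β
    rw [hF, ModuleCat.hom_comp, LinearMap.comp_apply, LinearMap.zero_apply] at h
    rw [map_zero]
    exact h.symm
  have h0 : 𝒥.descPointed P _ (Jacobian.point_comp_mul_const_inv P F) = 0 :=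
    hom_eq_zero_of_bettiCohomology_map_one_eq_zero _ hu
  have hG := 𝒥.abelJacobi_descPointed P _ (Jacobian.point_comp_mul_const_inv P F)
  rw [h0, AbelianVariety.hom_hom_hom_zero, MonObj.comp_one] at hG
  have h1 : F * (toSpecOver X ≫ (P ≫ F))⁻¹ = 1 := hG.symm
  calc F = F * (toSpecOver X ≫ (P ≫ F))⁻¹ * (toSpecOver X ≫ (P ≫ F)) := by rw [inv_mul_cancel_right]
    _ = toSpecOver X ≫ (P ≫ F) := by rw [h1, _root_.one_mul]

/-- **`F^* = 0` on `H¹(−(ℂ); ℚ)` iff `F` is constant** (`X` smooth projective, `A` an abelian variety).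
[cite: Milne1986JacobianVarieties, §6 Prop. 6.1] [cite: LangeBirkenhake1992, §1.1.2 (p. 10)] -/
theorem hom_bettiCohomology_map_one_eq_zero_iff_exists_eq_const (hX : IsSmoothProjective d X) (F : X ⟶ A.X) :
    (bettiCohomology.map F 1).hom = 0 ↔ ∃ a : A.Points ℂ, F = toSpecOver X ≫ a := by
  obtain ⟨P⟩ := hX.nonempty_algPoints ℂ
  refine ⟨fun h => ⟨P ≫ F, eq_const_of_hom_bettiCohomology_map_one_eq_zero A hX P F h⟩, ?_⟩
  rintro ⟨a, rfl⟩
  exact hom_bettiCohomology_map_one_const_eq_zero A hX a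

/-- `F^* ≠ 0` on `H¹(−(ℂ); ℚ)` iff `F` is non-constant (`X` smooth projective). [cite: Milne1986JacobianVarieties, §6 Prop. 6.1]
[cite: LangeBirkenhake1992, §1.1.2 (p. 10)] -/
theorem hom_bettiCohomology_map_one_ne_zero_iff_forall_ne_const (hX : IsSmoothProjective d X) (F : X ⟶ A.X) :
    (bettiCohomology.map F 1).hom ≠ 0 ↔ ∀ a : A.Points ℂ, F ≠ toSpecOver X ≫ a := by
  rw [Ne, hom_bettiCohomology_map_one_eq_zero_iff_exists_eq_const A hX F, not_exists]

/-! ### Non-constant morphisms and the Albanese -/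

/-- **`X` admits a NON-CONSTANT morphism to the abelian variety `A` iff `Hom(Alb X, A) ≠ 0`** (`X` smooth
projective, `𝒥` any Albanese datum): the classical form of the Albanese dictionary
(`Jacobian.exists_hom_bettiCohomology_map_ne_zero_iff_exists_hom_ne_zero` read through
`hom_bettiCohomology_map_one_ne_zero_iff_forall_ne_const`). In the Hodge-CM application: «the Picard modular surface
`P_Γ` maps non-trivially to the CM abelian variety `A_{(F,ψ)}`» iff «`A_{(F,ψ)}` meets `Alb(P_Γ)`».
[cite: Badescu2001, Ch. 5 Def. 5.2 and Thm. 5.3] [cite: Milne1986JacobianVarieties, §6 Prop. 6.1]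
[cite: LangeBirkenhake1992, §1.1.2 (p. 10)] -/
theorem Jacobian.exists_ne_const_iff_exists_hom_ne_zero (𝒥 : Jacobian X) (hX : IsSmoothProjective d X) :
    (∃ F : X ⟶ A.X, ∀ a : A.Points ℂ, F ≠ toSpecOver X ≫ a) ↔ ∃ u : 𝒥.J ⟶ A, u ≠ 0 := by
  rw [← 𝒥.exists_hom_bettiCohomology_map_ne_zero_iff_exists_hom_ne_zero A hX]
  exact exists_congr fun F => (hom_bettiCohomology_map_one_ne_zero_iff_forall_ne_const A hX F).symm

/-- Contrapositive form: **every morphism `X → A` is constant iff `Hom(Alb X, A) = 0`** (`X` smooth projective).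
[cite: Badescu2001, Ch. 5 Def. 5.2 and Thm. 5.3] [cite: LangeBirkenhake1992, §1.1.2 (p. 10)] -/
theorem Jacobian.forall_exists_eq_const_iff_forall_hom_eq_zero (𝒥 : Jacobian X) (hX : IsSmoothProjective d X) :
    (∀ F : X ⟶ A.X, ∃ a : A.Points ℂ, F = toSpecOver X ≫ a) ↔ ∀ u : 𝒥.J ⟶ A, u = 0 := by
  rw [← 𝒥.forall_hom_bettiCohomology_map_eq_zero_iff_forall_hom_eq_zero A hX]
  exact forall_congr' fun F => (hom_bettiCohomology_map_one_eq_zero_iff_exists_eq_const A hX F).symm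

end Literature.AlgebraicGeometry.Motives

end
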